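/-
Copyright (c) 2026 the pub-hodgecm-mathlib formalisation cell (harness21).  Prover seat hodgecm-mathlib-K2E4-p13 (g0),
Track B «K2-LIT» ∕ h413, ENGINE E4 unit U6 `ArchLimitConstant`, socket #13 `sig_K2E4ArchTransferValueNonvanishing` — THE JUNCTION
«#13 ⟸ #9 + #12 + (vi)».  2026-09-03.
-/
import Literature.NumberTheory.Rogawski1990.ArchimedeanTransfer
import HarnessLib

/-!
# K2 · E4 · U6 socket #13 `ArchTransferValueNonvanishing` — the JUNCTION: a non-zero singular constant (#9) and a non-zero singular functional (#12) give a
# `Δ‴_∞`-transfer pair charging `γ_H ⊗ 1` (Rogawski 1990 Prop. 8.2.1 (a) p. 118; Lemma 14.5.2 (b) p. 238)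

Cell `pub/hodgecm-mathlib` (D-0151), HCML Track B (21-frontier RULING «PUSH BOTH» 2026-09-03; K2-lead SKELETON LANDED K2E4, REQUESTS l.72384:
#13 ↦ base K2E4-p13), socket module `Summits/HodgeConjecture/HodgeConjecture/Cruxes/H413/Lines/K2_E4_SingularTransferKappaSignSigsArchLimitConstant.lean`
(planner K2E4-plan (g0)), crux H413 = `stmt-HodgeConjecture-24833`.

WHY THIS FILE.  Socket #13 `sig_K2E4ArchTransferValueNonvanishing` («SOME smooth archimedean `Δ‴_∞`-transfer pair `(aH, a)` has `aH(γ_H ⊗ 1) ≠ 0`»,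
`γ_H = (e₁•1₂, e₂)`, `e₁ ≠ e₂`) carries NO content independent of socket #9 `sig_K2E4ExplicitArchSingularTransfer` («ONE `cinf ≠ 0` with
`Φ^{st,sing}_∞(a)(γ₀ ⊗ 1) = cinf · aH(γ_H ⊗ 1)` for every smooth transfer pair»): the relation (vi) `IsArchDeltaTransfer` pins only the `G`-REGULAR stable
orbital integrals of `aH`, the evaluation at the `H`-central point `γ_H ⊗ 1` is a stable distribution (Harish-Chandra's rank-one limit formula, ★
`exists_tendsto_deriv_two_sin_smul_integral_integral_insert`; its descent with values is ★ `ArchEndoscopicCentralDescentValue`, p854794), so `aH(γ_H ⊗ 1)` is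
DETERMINED by `a` and its non-vanishing is the value computation of #9.  Conversely, GIVEN #9's constant and #12's non-zero singular functional
(`sig_K2E4ArchStableIntegralNonvanishing`: some smooth `a` with `Φ^{st,sing}_∞(a)(γ₀ ⊗ 1) ≠ 0`), the existence conjunct (vi) `IsArchDeltaTransferExists` of ★
`ArchCanonicalSingularMatrix` supplies a smooth `aH` for that `a`, and `cinf · aH(γ_H ⊗ 1) = Φ^{st,sing}_∞(a)(γ₀ ⊗ 1) ≠ 0`.  This file records that junction
ABSTRACTLY in the singular functional `Φ` and the evaluation point `y` (so that it serves verbatim for Weil's singular top-form family and the point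
`(γ_H.1 ⊗ 1, γ_H.2 ⊗ 1)` of the socket): the closing file `Theorems/K2E4ArchTransferValueNonvanishing.lean` is this lemma applied to
`Theorems/K2E4ExplicitArchSingularTransfer` (#9) and `Theorems/K2E4ArchStableIntegralNonvanishing` (#12) once both are ★.

* §1 **`exists_transferPair_apply_ne_zero_of_singularConstant`** — for an archimedean factor `T`, measure families `mH, mG`: from (vi)
  `IsArchDeltaTransferExists L H′ T mH mG (ArchSmooth L 3 H′) (ArchSmooth₂ L)`, a constant `cinf ≠ 0` with `Φ a = cinf · aH y` on smooth transfer pairs, and a smooth `a`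
  with `Φ a ≠ 0`: `∃ (aH, a)` smooth, `IsArchDeltaTransfer L H′ T mH mG aH a`, `aH y ≠ 0`.
* §1 `apply_eq_zero_of_singularConstant_of_eq_zero` — the kernel direction of the same constant (#11's shape from #9): `Φ a = 0 ⇒ aH y = 0`.
HONEST LABEL: HC_CM is proved only modulo the 7 printed citations (2 remaining named inputs: hLiu418 = stmt-HodgeConjecture-24832, h413 =
stmt-HodgeConjecture-24833) until rung 0 closes; this file is logic over the ★ vocabulary and pays no socket by itself (#13 closes BY NAME only with #9 and #12).

## References
* [Rogawski1990] J. D. Rogawski, *Automorphic Representations of Unitary Groups in Three Variables*, Ann. of Math. Stud. 123 (1990), §8.2 Prop. 8.2.1 (a)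
  pp. 118–119; §14.5 Lemma 14.5.2 (b) p. 238; §14.3 p. 234 (existence of `f′^H_∞`).
-/

set_option autoImplicit false

noncomputable section

open MeasureTheory NumberField

namespace Summit.HodgeConjecture.HodgeConjecture.Cruxes.H413.K2E4ArchTransferValueNonvanishingJunction

open Literature.NumberTheory.Rogawski1990 Literature.NumberTheory.Automorphic

variable {L : Type} [Field L] [NumberField L] [IsCMField L] {H' : Matrix (Fin 3) (Fin 3) L}
    {_ha : ∀ a : (UnitaryGroup.arch (↥(maximalRealSubfield L)) L (IsCMField.complexConj L) 2
          (Matrix.of fun i j : Fin 2 => if i.val + j.val + 1 = 2 then (1 : L) else 0) ×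
        UnitaryGroup.arch (↥(maximalRealSubfield L)) L (IsCMField.complexConj L) 1
          (Matrix.of fun i j : Fin 1 => if i.val + j.val + 1 = 1 then (1 : L) else 0)),
      MeasurableSpace ((UnitaryGroup.arch (↥(maximalRealSubfield L)) L (IsCMField.complexConj L) 2
          (Matrix.of fun i j : Fin 2 => if i.val + j.val + 1 = 2 then (1 : L) else 0) ×
        UnitaryGroup.arch (↥(maximalRealSubfield L)) L (IsCMField.complexConj L) 1
          (Matrix.of fun i j : Fin 1 => if i.val + j.val + 1 = 1 then (1 : L) else 0)) ⧸
        Subgroup.centralizer ({a} : Set (UnitaryGroup.arch (↥(maximalRealSubfield L)) L (IsCMField.complexConj L) 2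
          (Matrix.of fun i j : Fin 2 => if i.val + j.val + 1 = 2 then (1 : L) else 0) ×
        UnitaryGroup.arch (↥(maximalRealSubfield L)) L (IsCMField.complexConj L) 1
          (Matrix.of fun i j : Fin 1 => if i.val + j.val + 1 = 1 then (1 : L) else 0))))}
    {_hγ : ∀ γ : UnitaryGroup.arch (↥(maximalRealSubfield L)) L (IsCMField.complexConj L) 3 H',
      MeasurableSpace (UnitaryGroup.arch (↥(maximalRealSubfield L)) L (IsCMField.complexConj L) 3 H' ⧸
        Subgroup.centralizer ({γ} : Set (UnitaryGroup.arch (↥(maximalRealSubfield L)) L (IsCMField.complexConj L) 3 H')))}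
    {T : ArchTransferFactor L H'}
    {mH : OrbitalMeasureFamily (UnitaryGroup.arch (↥(maximalRealSubfield L)) L (IsCMField.complexConj L) 2
          (Matrix.of fun i j : Fin 2 => if i.val + j.val + 1 = 2 then (1 : L) else 0) ×
        UnitaryGroup.arch (↥(maximalRealSubfield L)) L (IsCMField.complexConj L) 1
          (Matrix.of fun i j : Fin 1 => if i.val + j.val + 1 = 1 then (1 : L) else 0))}
    {mG : OrbitalMeasureFamily (UnitaryGroup.arch (↥(maximalRealSubfield L)) L (IsCMField.complexConj L) 3 H')}

/-! ## §1 The junction -/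

/-- **#13 ⟸ #9 + #12 + (vi).**  Let `Φ` be any functional on `G′_∞`-test functions (in U6: Weil's singular stable orbital integral `a ↦ Φ^{st}_{m^{sing}}(a)(γ₀ ⊗ 1)`) and `y ∈ H_∞`
any point (in U6: `γ_H ⊗ 1 = ((e₁•1₂) ⊗ 1, e₂ ⊗ 1)`).  If (vi) every smooth `a` has a smooth `Δ′_∞`-transfer `aH` (`IsArchDeltaTransferExists`, conjunct of ★ `ArchCanonicalSingularMatrix`),
if ONE constant `cinf ≠ 0` gives `Φ a = cinf · aH y` on every smooth transfer pair (#9 `sig_K2E4ExplicitArchSingularTransfer`), and if `Φ a ≠ 0` for some smooth `a`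
(#12 `sig_K2E4ArchStableIntegralNonvanishing`), then some smooth transfer pair `(aH, a)` has `aH y ≠ 0` (#13 `sig_K2E4ArchTransferValueNonvanishing`).
[cite: Rogawski1990, §8.2 Prop. 8.2.1 (a) p. 118; §14.5 Lemma 14.5.2 (b) p. 238; §14.3 p. 234] -/
theorem exists_transferPair_apply_ne_zero_of_singularConstant
    (Φ : (UnitaryGroup.arch (↥(maximalRealSubfield L)) L (IsCMField.complexConj L) 3 H' → ℂ) → ℂ)
    (y : UnitaryGroup.arch (↥(maximalRealSubfield L)) L (IsCMField.complexConj L) 2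
          (Matrix.of fun i j : Fin 2 => if i.val + j.val + 1 = 2 then (1 : L) else 0) ×
        UnitaryGroup.arch (↥(maximalRealSubfield L)) L (IsCMField.complexConj L) 1
          (Matrix.of fun i j : Fin 1 => if i.val + j.val + 1 = 1 then (1 : L) else 0))
    (hvi : IsArchDeltaTransferExists L H' T mH mG (ArchSmooth L 3 H') (ArchSmooth₂ L))
    (h9 : ∃ cinf : ℂ, cinf ≠ 0 ∧
      ∀ (aH : UnitaryGroup.arch (↥(maximalRealSubfield L)) L (IsCMField.complexConj L) 2
              (Matrix.of fun i j : Fin 2 => if i.val + j.val + 1 = 2 then (1 : L) else 0) ×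
            UnitaryGroup.arch (↥(maximalRealSubfield L)) L (IsCMField.complexConj L) 1
              (Matrix.of fun i j : Fin 1 => if i.val + j.val + 1 = 1 then (1 : L) else 0) → ℂ)
        (a : UnitaryGroup.arch (↥(maximalRealSubfield L)) L (IsCMField.complexConj L) 3 H' → ℂ),
        ArchSmooth L 3 H' a → ArchSmooth₂ L aH → IsArchDeltaTransfer L H' T mH mG aH a → Φ a = cinf * aH y)
    (h12 : ∃ a : UnitaryGroup.arch (↥(maximalRealSubfield L)) L (IsCMField.complexConj L) 3 H' → ℂ, ArchSmooth L 3 H' a ∧ Φ a ≠ 0) :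
    ∃ (aH : UnitaryGroup.arch (↥(maximalRealSubfield L)) L (IsCMField.complexConj L) 2
              (Matrix.of fun i j : Fin 2 => if i.val + j.val + 1 = 2 then (1 : L) else 0) ×
            UnitaryGroup.arch (↥(maximalRealSubfield L)) L (IsCMField.complexConj L) 1
              (Matrix.of fun i j : Fin 1 => if i.val + j.val + 1 = 1 then (1 : L) else 0) → ℂ)
      (a : UnitaryGroup.arch (↥(maximalRealSubfield L)) L (IsCMField.complexConj L) 3 H' → ℂ),
      ArchSmooth L 3 H' a ∧ ArchSmooth₂ L aH ∧ IsArchDeltaTransfer L H' T mH mG aH a ∧ aH y ≠ 0 := by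
  obtain ⟨a, ha, hΦa⟩ := h12
  obtain ⟨aH, haH, htr⟩ := hvi a ha
  obtain ⟨cinf, -, hc⟩ := h9
  refine ⟨aH, a, ha, haH, htr, fun hy => hΦa ?_⟩
  rw [hc aH a ha haH htr, hy, mul_zero]

/-- The kernel direction of the same constant (#11 `sig_K2E4ArchSingularKernel` from #9): if `Φ a = cinf · aH y` with `cinf ≠ 0` on the smooth transfer pair `(aH, a)` and
`Φ a = 0`, then `aH y = 0`. [cite: Rogawski1990, §8.2 Prop. 8.2.1 (a) p. 118; §14.5 Lemma 14.5.2 (b) p. 238] -/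
theorem apply_eq_zero_of_singularConstant_of_eq_zero
    (Φ : (UnitaryGroup.arch (↥(maximalRealSubfield L)) L (IsCMField.complexConj L) 3 H' → ℂ) → ℂ)
    (y : UnitaryGroup.arch (↥(maximalRealSubfield L)) L (IsCMField.complexConj L) 2
          (Matrix.of fun i j : Fin 2 => if i.val + j.val + 1 = 2 then (1 : L) else 0) ×
        UnitaryGroup.arch (↥(maximalRealSubfield L)) L (IsCMField.complexConj L) 1
          (Matrix.of fun i j : Fin 1 => if i.val + j.val + 1 = 1 then (1 : L) else 0))
    (h9 : ∃ cinf : ℂ, cinf ≠ 0 ∧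
      ∀ (aH : UnitaryGroup.arch (↥(maximalRealSubfield L)) L (IsCMField.complexConj L) 2
              (Matrix.of fun i j : Fin 2 => if i.val + j.val + 1 = 2 then (1 : L) else 0) ×
            UnitaryGroup.arch (↥(maximalRealSubfield L)) L (IsCMField.complexConj L) 1
              (Matrix.of fun i j : Fin 1 => if i.val + j.val + 1 = 1 then (1 : L) else 0) → ℂ)
        (a : UnitaryGroup.arch (↥(maximalRealSubfield L)) L (IsCMField.complexConj L) 3 H' → ℂ),
        ArchSmooth L 3 H' a → ArchSmooth₂ L aH → IsArchDeltaTransfer L H' T mH mG aH a → Φ a = cinf * aH y)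
    {aH : UnitaryGroup.arch (↥(maximalRealSubfield L)) L (IsCMField.complexConj L) 2
              (Matrix.of fun i j : Fin 2 => if i.val + j.val + 1 = 2 then (1 : L) else 0) ×
            UnitaryGroup.arch (↥(maximalRealSubfield L)) L (IsCMField.complexConj L) 1
              (Matrix.of fun i j : Fin 1 => if i.val + j.val + 1 = 1 then (1 : L) else 0) → ℂ}
    {a : UnitaryGroup.arch (↥(maximalRealSubfield L)) L (IsCMField.complexConj L) 3 H' → ℂ}
    (ha : ArchSmooth L 3 H' a) (haH : ArchSmooth₂ L aH) (htr : IsArchDeltaTransfer L H' T mH mG aH a) (hΦ : Φ a = 0) :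
    aH y = 0 := by
  obtain ⟨cinf, hcinf, hc⟩ := h9
  have h := hc aH a ha haH htr
  rw [hΦ] at h
  exact (mul_eq_zero.1 h.symm).resolve_left hcinf

end Summit.HodgeConjecture.HodgeConjecture.Cruxes.H413.K2E4ArchTransferValueNonvanishingJunction

end
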